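import Mathlib
import HarnessLib
import Literature.MathematicalPhysics.QuantumLattice.GaugeGroups
import Literature.MathematicalPhysics.QuantumFieldTheory.ConstructiveQFTWave0
import Literature.MathematicalPhysics.QuantumFieldTheory.UnitaryCayleyChart
import Summits.Ventures.LatticeQCDFlow.Scaling.ExactTransportOneSidedInstances

/-!
# LatticeQCDFlow / Scaling — barrier supplement v2.6: transport rigidity is ONE-SIDED (expansion `e^{cβ}`, contraction `β^{Θ(1)}`)

HONEST FRAMING: exact (Metropolis-corrected) sampling algorithms for lattice gauge theory;
figures of merit are autocorrelation/cost numbers at stated couplings and volumes; no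
continuum-physics claim.

THEORY-2.md §5.11 (theory seat GEN-11).  Two PROVED supplements to the T4 entry `ExactnessVsExpressivity`
(`Scaling/Barriers.lean`, THEORY-2.md §5.3: "claims of β-uniform quality for a fixed-depth flow from the Haar prior")
and to the layer-depth law (`Scaling/ExactTransportDepth*.lean`), in the barrier-docstring format
(`technique_class` · `blocks` · `because` · `evasions_known` · `scope_caveats` · `nearest_prior_art` · `status`), each a
`def … : Prop` immediately DISCHARGED by the instances of `Scaling/ExactTransportOneSidedInstances.lean`.  They record
that the bi-Lipschitz rigidity (C2a)/(C2a-R) of an EXACT transport `T_*Haar^{⊗E} = μ_{Λ,β}` splits into an EXPANSION law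
`Lip(T) ≥ e^{cβ}` (an exactness artefact, uniformly in the volume) and a CONTRACTION law `coLip(T) ≥ e^{-C}β^{c}` (the
entropy side, polynomial per link) — so that a route's BC8 line can say which side it is on.  The barrier NAMES of record
(VolumeScalingOfTraining, TopologicalModeCollapse, ExactnessVsExpressivity, FermionDeterminantCost) are unchanged; the
literature named under `nearest_prior_art` is CONTEXT found by search (THEORY-2.md §8 (39)), nothing is imported from it.
-/

noncomputable section

namespace Summit.Ventures.LatticeQCDFlow.Barriers

open scoped Matrix.Norms.Frobenius
open Literature.MathematicalPhysics.QuantumFieldTheory.UnitaryCayley (𝔾)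
open Literature.MathematicalPhysics.QuantumLattice (u1Rep unitaryFundamentalRep fundamentalRep)

/-- **Supplement (TransportExpansionLaw) to ExactnessVsExpressivity — the `e^{cβ}` of (C2a) is an
EXPANSION statement, uniform in the volume.**  For `G = U(1)` (chordal metric), `G = U(N)`, `N ≥ 1`,
and `G = SU(N)`, `N ≥ 2` (Hilbert–Schmidt metric), Wilson action in the defining representation,
`d ≥ 2`: there are `c > 0` and `β₀` such that for every `L ≥ 2`, every `β ≥ β₀` and every map
`T : G^E → G^E` that is `K`-Lipschitz for the sup metric and EXACT, `T_*Haar^{⊗E} = μ_{Λ_L,β}`, one has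
`K ≥ e^{cβ}` (`c = s₀/(8κd)`, `κ = dim G`, `s₀` the extensive-action constant; no co-Lipschitz,
injectivity or smoothness hypothesis).
technique_class: deterministic samplers realised as ONE Lipschitz map of the product-Haar
  (strong-coupling) prior with exact push-forward — trivializing maps and gauge-equivariant
  coupling / residual / spectral / continuous flows read at accuracy `ε = 0`, any depth.
blocks: "a trivializing map from the Haar prior with Lipschitz constant bounded uniformly in β
  (and L)" — false for every `d ≥ 2` as soon as the character is non-constant; per-layer Lipschitz
  clamps `Λ` with depth `n`: `n·log Λ ≥ c·β` for an exact flow (the layer-depth law).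
because: PROVED `Theory2.Lattice.U1.exactTransportExpansion`, `….UN.exactTransportExpansion`,
  `….SUN.exactTransportExpansion` (`exactTransportExpansion_of_ballVolumes`: the partition function is
  at least `e^{-βs₀L^d/4}·(a r₀^κ)^{#E}` from a VOLUME-UNIFORM low-action sup-ball about the identity
  configuration, while an exact `K`-Lipschitz `T` must cover a ball about an image point of action
  `> s₀L^d/2` by the image of a prior ball of radius `r/K`, giving
  `κd·log K ≥ β s₀/4 − d·C₁` per unit volume).
evasions_known: (i) ε-ACCURACY — the law is an EXACTNESS ARTEFACT: the configurations of action
  `> s₀L^d/2` carry `μ_β`-mass `e^{-Θ(βL^d)}`, so an `ε`-accurate flow may ignore them; the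
  ε-robust obstruction is the contraction / entropy side only (`TransportContractionLaw`,
  `EntropyBudgetLaw`); (ii) a TAILED reference measure instead of compact Haar (Gaussian /
  Lie-algebra-valued prior, heat-bath prior at `β₀ < β`): the rigorous Polchinski / Langevin
  transport maps of lattice `φ⁴` and sine-Gordon FROM THE GAUSSIAN FREE FIELD are Lipschitz
  uniformly in the volume off criticality (Bauerschmidt–Bodineau–Dagallier, Probab. Surveys 21
  (2024) = arXiv:2307.07619, Thm 6 p. 30, Thm 7 p. 31, Example 10 p. 37: "for any `r > r_c(g)`, the
  transport map of Theorem 7 has Lipschitz constant bounded uniformly in `L` and `t`"; Shenfeld,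
  arXiv:2205.01642, main theorem p. 5: `exp(½∫λ̇_t dt)`-Lipschitz under the multiscale Bakry–Émery
  criterion) — there the expansion is supplied by the reference's tails, here it must be supplied by
  the map.
scope_caveats: EXACT transport only (nothing is claimed about KL / ESS of an approximate flow);
  `c` is not sharp; between two couplings `β₀ < β` only the markdown form `log K ≥ c(β − β₀) − C` is
  asserted (THEORY-2.md §3.3 v2.6), not formalised.
nearest_prior_art: bi-Lipschitz obstruction for EXACT flows onto well-separated multimodal targets
  (Cornish–Caterini–Deligiannidis–Doucet, ICML 2020 = arXiv:1909.13833 Thm 2.1; THEORY-2.md L-3) —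
  volume-free and separation-driven, whereas here the growth comes from a compact prior + an
  extensive action with no mode structure used; volume-uniform Lipschitz transport for `φ⁴` /
  sine-Gordon from a Gaussian (arXiv:2307.07619, 2205.01642, Serres arXiv:2208.08186) — the
  positive results this law says cannot be copied verbatim to a compact-group prior; rigorous
  Langevin / log-Sobolev / mass gap for lattice Yang–Mills(–Higgs) at SMALL β only (Shen–Zhu–Zhu
  arXiv:2401.13299 Thm 1.2–1.4; Nissim arXiv:2510.22788 Thm 1).  Searched (THEORY-2.md §8 (39)): no
  printed β-growth law for exact transport of a lattice gauge measure from product Haar.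
status: PROVED (`transportExpansionLaw`). -/
def TransportExpansionLaw : Prop :=
  (∀ d : ℕ, 2 ≤ d → Theory2.Lattice.ExactTransportExpansion d 1 Circle u1Rep) ∧
  (∀ d N : ℕ, 2 ≤ d → 1 ≤ N →
    @Theory2.Lattice.ExactTransportExpansion d N (𝔾 N) _ Subtype.metricSpace
      Theory2.Lattice.UN.isTopologicalGroup_hs Theory2.Lattice.UN.compactSpace_hs _
      Theory2.Lattice.UN.borelSpace_hs (unitaryFundamentalRep (Fin N) ℂ)) ∧
  (∀ d N : ℕ, 2 ≤ d → 2 ≤ N →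
    @Theory2.Lattice.ExactTransportExpansion d N (Matrix.specialUnitaryGroup (Fin N) ℂ) _ Subtype.metricSpace
      Theory2.Lattice.SUN.isTopologicalGroup_hs Theory2.Lattice.SUN.compactSpace_hs _
      Theory2.Lattice.SUN.borelSpace_hs (fundamentalRep (Fin N)))

/-- Discharge of `TransportExpansionLaw` by the three instances of
`Scaling/ExactTransportOneSidedInstances.lean`. -/
theorem transportExpansionLaw : TransportExpansionLaw :=
  ⟨Theory2.Lattice.U1.exactTransportExpansion, Theory2.Lattice.UN.exactTransportExpansion,
    Theory2.Lattice.SUN.exactTransportExpansion⟩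

/-- **Supplement (TransportContractionLaw) to ExactnessVsExpressivity / EntropyBudgetLaw — the
concentration of `μ_β` forces only POLYNOMIAL contraction per link.**  Same groups and metrics,
`d ≥ 2`: there are `c = 1/(16d)`, `C`, `β₀` such that for every `L ≥ 4`, every `β ≥ β₀` and every
map `T : G^E → G^E` that is `K'`-co-Lipschitz (`dist x y ≤ K'·dist (Tx) (Ty)`) and EXACT, one has
`log K' ≥ c·log β − C`, i.e. `K' ≥ e^{-C}·β^{c}` (no Lipschitz or measurability hypothesis —
a.e.-measurability follows from exactness).
technique_class: as `TransportExpansionLaw`; this is the side that every flow from the Haar prior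
  must pay ALSO at accuracy `ε > 0` (in its volume form it is the entropy budget: total log-Jacobian
  `≥ (n_tr/2)(1 − O(1/L))·log β − O(V)`).
blocks: reading (C2a) as "exact flows must be exponentially contracting in β": the contraction an
  exact transport needs is `β^{Θ(1)}` per link (extensive only as a log-Jacobian), and the whole
  `e^{cβ}` of the product law `Lip·coLip ≥ e^{cβ}` sits on the expansion side.
because: PROVED `Theory2.Lattice.U1.exactTransportContraction`, `….UN.exactTransportContraction`,
  `….SUN.exactTransportContraction` (`exactTransportContraction_of_laplaceHalfMass` fed with the
  PROVED Laplace half-mass laws `U1/UN/SUN.laplaceHalfMass`: `Z ≤ 2(c₀/β)^{nTr/2}` against the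
  density ratio at an image point of action `< 1/β`, `nTr ≥ κL^d/8` for `L ≥ 4`).
evasions_known: none needed on this side — it is paid, not evaded: `log coLip = Θ(log β)` per link
  is exactly what a heat-bath-like single-link squeeze supplies; multi-scale / annealed
  constructions distribute it over rungs (`Σ_rungs log(β_{k+1}/β_k) = log(β/β₀)`).
scope_caveats: necessary, not sufficient; the constant `1/(16d)` is far from the entropy-budget
  coefficient `dim G·(d−1)/2` per site because a sup-metric co-Lipschitz constant only sees the
  worst link; `L ≥ 4` is where the tree's transverse count `nTr(L)` is `≥ κL^d/8`.
nearest_prior_art: information-based complexity of sampling / log-partition estimation for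
  non-log-concave densities (Holzmüller–Bach, JMLR 26 (2025) = arXiv:2303.03237, Thm 6: minimax
  rates `Θ(B n^{-m/d})` in the number `n` of density evaluations) — a different currency (query
  complexity, no transport map); tempering / SMC complexity on multimodal targets (Syed et al.
  NRPT = arXiv:1905.02939 Thm 3: round-trip rate `1/(2+2Λ)` with the global barrier `Λ`;
  Woodard–Schmidler–Huber, EJP 14 (2009): torpid mixing of parallel / simulated tempering from a
  low-conductance, low-persistence set; Mathews–Schmidler, Ann. Appl. Probab. 2024 =
  arXiv:2208.06672: SMC sample complexity from LOCAL mixing times) — these price the annealing /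
  ladder classes of THEORY-2.md §5.1–§5.2, not single-map transport; nothing found states a
  polynomial-in-β co-Lipschitz floor for exact lattice-gauge transport (THEORY-2.md §8 (39)).
status: PROVED (`transportContractionLaw`). -/
def TransportContractionLaw : Prop :=
  (∀ d : ℕ, 2 ≤ d → Theory2.Lattice.ExactTransportContraction d 1 Circle u1Rep) ∧
  (∀ d N : ℕ, 2 ≤ d → 1 ≤ N →
    @Theory2.Lattice.ExactTransportContraction d N (𝔾 N) _ Subtype.metricSpace
      Theory2.Lattice.UN.isTopologicalGroup_hs Theory2.Lattice.UN.compactSpace_hs _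
      Theory2.Lattice.UN.borelSpace_hs (unitaryFundamentalRep (Fin N) ℂ)) ∧
  (∀ d N : ℕ, 2 ≤ d → 2 ≤ N →
    @Theory2.Lattice.ExactTransportContraction d N (Matrix.specialUnitaryGroup (Fin N) ℂ) _ Subtype.metricSpace
      Theory2.Lattice.SUN.isTopologicalGroup_hs Theory2.Lattice.SUN.compactSpace_hs _
      Theory2.Lattice.SUN.borelSpace_hs (fundamentalRep (Fin N)))

/-- Discharge of `TransportContractionLaw` by the three instances of
`Scaling/ExactTransportOneSidedInstances.lean`. -/
theorem transportContractionLaw : TransportContractionLaw :=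
  ⟨Theory2.Lattice.U1.exactTransportContraction, Theory2.Lattice.UN.exactTransportContraction,
    Theory2.Lattice.SUN.exactTransportContraction⟩

end Summit.Ventures.LatticeQCDFlow.Barriers

end
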